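import Summits.PneNP.PneNP.Theorems.SymmetryBudgetNoHiddenOrderProgramLevels

/-!
# `NoHiddenOrder` (stmt-PneNP-14781), (R2c) VI: the window canoniser program — ranks I: bounds, the `Pre` discipline, small shapes

Route `PneNP/SymmetryBudget`; continues `SymmetryBudgetNoHiddenOrderProgramLevels.lean`.  Towards `rank_lt` (sources have smaller rank):
the coordinate bounds `lvl_lt_LV`, `blk_lt_BL`, `ms_lt_MS` and the master lemma `rank_lt_of_L4`; the predicate `Pre t s b lv w` ("wire
`w` may be read by a gate at coordinates `(t, s, b, lv)`": it is an input, or a gate lexicographically below) with its weakenings; and, for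
the small shapes, that every source of a shape gate is `Pre` at the gate's coordinates given that the shape's inputs are and that the shape
is embedded at the right levels (`pre_ccSrcs`, `pre_ctSrcs`, `pre_vsSrcs`, `pre_voSrcs`, `pre_vaSrcs`, `pre_riSrcs`).  Supports
stmt-PneNP-14781.
-/

set_option linter.dupNamespace false -- `Summit.PneNP.PneNP.…` (D-0017 single-conjunct layout)

namespace Summit.PneNP.PneNP.Theorems

open Finset CGBits BranchSum Literature.Computability.Complexity Literature.Computability.Complexity.SymProg

namespace WCanon.R2c

variable {m : ℕ}

/-! ### Level bounds

(Strict forms: the level TABLES here are `WCanon.R2c.*`, distinct from the parallel `WCanon.*` tables of `…ProgramLvlsA.lean`.) -/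

/-- Bound. -/
theorem ccLvl_lt (g : CCGate m) : ccLvl g < 4 := by cases g <;> simp [ccLvl]

/-- Bound. -/
theorem ctLvl_lt (g : CTGate m) : ctLvl g < 4 := by cases g <;> simp [ctLvl]

/-- Bound. -/
theorem vsLvl_lt (g : VSGate m) : vsLvl g < 4 := by cases g <;> simp [vsLvl]

/-- Bound. -/
theorem voLvl_lt (g : VOGate m) : voLvl g < 4 := by cases g <;> simp [voLvl]

/-- Bound. -/
theorem vaLvl_lt (g : VAGate m) : vaLvl g < 4 := by cases g <;> simp [vaLvl]

/-- Bound. -/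
theorem riLvl_lt (g : RIGate m) : riLvl g < 12 * wn m + 6 := by
  cases g <;> simp only [riLvl] <;> (try have := ccLvl_lt ‹CCGate m›) <;> omega

/-- Bound. -/
theorem anLvl_lt (g : AnGate m) : anLvl g < 2 * wn m + 21 := by
  cases g <;> simp only [anLvl] <;> (try have := ccLvl_lt ‹CCGate m›) <;> (try have := ctLvl_lt ‹CTGate m›) <;> omega

/-- Bound. -/
theorem trLvl_lt (g : TrGate m) : trLvl g < 12 * wn m + 11 := by
  cases g <;> simp only [trLvl] <;> (try have := riLvl_lt ‹RIGate m›) <;> omega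

/-- Bound. -/
theorem orLvl_lt (g : OrGate m) : orLvl g < 12 * wn m + 20 := by
  cases g <;> simp only [orLvl] <;> (try have := riLvl_lt ‹RIGate m›) <;> (try have := voLvl_lt ‹VOGate m›) <;> omega

/-- Bound. -/
theorem andLvl_lt (g : AndGate m) : andLvl g < 15 := by
  cases g <;> simp only [andLvl] <;> (try have := vaLvl_lt ‹VAGate m›) <;> omega

/-- Bound. -/
theorem vlLvl_lt (g : VlGate m) : vlLvl g < 3 := by cases g <;> simp [vlLvl]

/-- The level coordinate is below its radix. [folklore] -/
theorem lvl_lt_LV (l : Gt m) : lvl l < LV m := by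
  cases l <;> simp only [lvl, LV] <;> (try have := vsLvl_lt ‹VSGate m›) <;> (try have := riLvl_lt ‹RIGate m›) <;>
    (try have := anLvl_lt ‹AnGate m›) <;> (try have := trLvl_lt ‹TrGate m›) <;> (try have := orLvl_lt ‹OrGate m›) <;>
    (try have := andLvl_lt ‹AndGate m›) <;> (try have := vlLvl_lt ‹VlGate m›) <;> omega

/-- The block coordinate is below its radix. [folklore] -/
theorem blk_lt_BL (l : Gt m) : blk l < BL m := by
  cases l <;> simp only [blk, BL] <;> omega

/-- Measures of labels are below the radix. [folklore] -/
theorem measure_lt_MS (L : CertifiedLabels.Label (WV m)) : L.measure < MS m := by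
  unfold CertifiedLabels.Label.measure MS
  have hU : L.U.card ≤ wn m := (card_le_univ _).trans (by rw [card_WV])
  have h1 : L.U.card * (Fintype.card (WV m) + 1) ≤ wn m * (wn m + 1) := by
    rw [card_WV]; exact Nat.mul_le_mul_right _ hU
  have h2 : Fintype.card (WV m) - L.X.card ≤ wn m := by rw [card_WV]; exact Nat.sub_le _ _
  omega

/-- The measure coordinate is below its radix. [folklore] -/
theorem ms_lt_MS (l : Gt m) : ms l < MS m := by
  cases l <;> simp only [ms] <;> first | exact measure_lt_MS _ | (unfold MS; omega)

/-! ### The `Pre` discipline -/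

/-- The strict lexicographic order on `ℕ⁴`, spelled out. -/
def L4 (a b c d a' b' c' d' : ℕ) : Prop := a < a' ∨ (a = a' ∧ (b < b' ∨ (b = b' ∧ (c < c' ∨ (c = c' ∧ d < d')))))

/-- **Sources below a gate lexicographically have smaller rank.** [folklore] -/
theorem rank_lt_of_L4 {l l' : Gt m} (h : L4 (tier l') (ms l') (blk l') (lvl l') (tier l) (ms l) (blk l) (lvl l)) : rank l' < rank l :=
  rank_lt_of_lex (ms_lt_MS l') (blk_lt_BL l') (lvl_lt_LV l') h

/-- `Pre t s b lv w`: the wire `w` may be read by a gate at coordinates `(t, s, b, lv)` — it is an input, or a gate lexicographically below.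
[folklore] -/
def Pre (t s b lv : ℕ) (w : Wire m) : Prop := ∀ l', w = Sum.inr l' → L4 (tier l') (ms l') (blk l') (lvl l') t s b lv

/-- Inputs may be read by anyone. -/
theorem pre_inl {t s b lv : ℕ} (q : Fin m × Fin m) : Pre t s b lv (Sum.inl q : Wire m) := fun _ h => by cases h

/-- `Pre` of a gate wire. -/
theorem pre_inr {t s b lv : ℕ} {l' : Gt m} : Pre t s b lv (Sum.inr l') ↔ L4 (tier l') (ms l') (blk l') (lvl l') t s b lv :=
  ⟨fun h => h l' rfl, fun h l'' e => by cases e; exact h⟩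

/-- A gate at the same tier, measure and block and a lower level. -/
theorem pre_gate {t s b lv : ℕ} {l' : Gt m} (ht : tier l' = t) (hs : ms l' = s) (hb : blk l' = b) (hl : lvl l' < lv) :
    Pre t s b lv (Sum.inr l') :=
  pre_inr.2 (by unfold L4; omega)

/-- A gate of lower tier. -/
theorem pre_tier {t s b lv : ℕ} {l' : Gt m} (ht : tier l' < t) : Pre t s b lv (Sum.inr l') := pre_inr.2 (Or.inl ht)

/-- A gate of the same tier and smaller measure. -/
theorem pre_ms {t s b lv : ℕ} {l' : Gt m} (ht : tier l' = t) (hs : ms l' < s) : Pre t s b lv (Sum.inr l') :=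
  pre_inr.2 (Or.inr ⟨ht, Or.inl hs⟩)

/-- A gate of the same tier and measure and a lower block. -/
theorem pre_blk {t s b lv : ℕ} {l' : Gt m} (ht : tier l' = t) (hs : ms l' = s) (hb : blk l' < b) : Pre t s b lv (Sum.inr l') :=
  pre_inr.2 (Or.inr ⟨ht, Or.inr ⟨hs, Or.inl hb⟩⟩)

/-- Weakening in the level. -/
theorem Pre.of_le {t s b lv lv' : ℕ} {w : Wire m} (h : Pre t s b lv w) (hle : lv ≤ lv') : Pre t s b lv' w := fun l' hl => by
  have := h l' hl; unfold L4 at *; omega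

/-- Weakening to a higher block. -/
theorem Pre.of_blk {t s b b' lv lv' : ℕ} {w : Wire m} (h : Pre t s b lv w) (hb : b < b') : Pre t s b' lv' w := fun l' hl => by
  have := h l' hl; unfold L4 at *; omega

/-- Weakening to a higher block or the same block and a higher level. -/
theorem Pre.of_blk_le {t s b b' lv lv' : ℕ} {w : Wire m} (h : Pre t s b lv w) (hb : b < b' ∨ (b = b' ∧ lv ≤ lv')) : Pre t s b' lv' w :=
  fun l' hl => by have := h l' hl; unfold L4 at *; omega

/-- The rank of a `Pre` source. -/
theorem rank_lt_of_pre {l l' : Gt m} {w : Wire m} (hw : Pre (tier l) (ms l) (blk l) (lvl l) w) (h : w = Sum.inr l') : rank l' < rank l :=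
  rank_lt_of_L4 (hw l' h)

/-! ### Small shapes -/

section shapes

variable {t s b base : ℕ}

/-- Sources of a `CmpCount` shape. [folklore] -/
theorem pre_ccSrcs {A B : Finset (Wire m)} {e : CCGate m → Gt m} (hA : ∀ w ∈ A, Pre t s b base w) (hB : ∀ w ∈ B, Pre t s b base w)
    (he : ∀ g, Pre t s b (base + ccLvl g + 1) (Sum.inr (e g))) (g : CCGate m) :
    ∀ w ∈ ccSrcs A B e g, Pre t s b (base + ccLvl g) w := by
  cases g <;>
    simp only [ccSrcs, ccLvl, Finset.forall_mem_insert, Finset.forall_mem_image, Finset.mem_singleton, forall_eq, Finset.mem_univ,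
      true_imp_iff] <;>
    (repeat' apply And.intro) <;>
    first
    | exact fun w hw => (hA w hw).of_le (Nat.le_add_right _ _)
    | exact fun w hw => (hB w hw).of_le (Nat.le_add_right _ _)
    | exact (he _).of_le (by simp only [ccLvl]; omega)
    | exact fun _ => (he _).of_le (by simp only [ccLvl]; omega)

/-- Sources of a `CmpTwice` shape. [folklore] -/
theorem pre_ctSrcs {A B : Finset (Wire m)} {e : CTGate m → Gt m} (hA : ∀ w ∈ A, Pre t s b base w) (hB : ∀ w ∈ B, Pre t s b base w)
    (he : ∀ g, Pre t s b (base + ctLvl g + 1) (Sum.inr (e g))) (g : CTGate m) :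
    ∀ w ∈ ctSrcs A B e g, Pre t s b (base + ctLvl g) w := by
  cases g <;>
    simp only [ctSrcs, ctLvl, Finset.forall_mem_insert, Finset.forall_mem_image, Finset.mem_singleton, forall_eq, Finset.mem_univ,
      Finset.mem_filter, true_and] <;>
    (repeat' apply And.intro) <;>
    first
    | exact fun w hw => (hA w hw).of_le (Nat.le_add_right _ _)
    | exact fun w hw => (hB w hw).of_le (Nat.le_add_right _ _)
    | exact (he _).of_le (by simp only [ctLvl]; omega)
    | exact fun _ _ => (he _).of_le (by simp only [ctLvl]; omega)

/-- Sources of the signature comparison shape. [folklore] -/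
theorem pre_vsSrcs {bw : WV m → Fin (m + m) → Wire m} {e : VSGate m → Gt m} (hb : ∀ k j, Pre t s b base (bw k j))
    (he : ∀ g, Pre t s b (base + vsLvl g + 1) (Sum.inr (e g))) (g : VSGate m) :
    ∀ w ∈ vsSrcs bw e g, Pre t s b (base + vsLvl g) w := by
  cases g <;>
    simp only [vsSrcs, vsLvl, Finset.forall_mem_insert, Finset.forall_mem_image, Finset.forall_mem_union, Finset.mem_singleton,
      forall_eq, Finset.mem_univ, Finset.mem_filter, true_and, true_imp_iff] <;>
    (repeat' apply And.intro) <;>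
    first
    | exact (hb _ _).of_le (Nat.le_add_right _ _)
    | exact (he _).of_le (by simp only [vsLvl]; omega)
    | exact fun _ => (he _).of_le (by simp only [vsLvl]; omega)
    | exact fun _ _ => (he _).of_le (by simp only [vsLvl]; omega)

/-- Sources of the candidates' comparison shape. [folklore] -/
theorem pre_voSrcs {bw : WV m × Fin (wn m) → Fin (NB (wn m)) → Wire m} {e : VOGate m → Gt m} (hb : ∀ k j, Pre t s b base (bw k j))
    (he : ∀ g, Pre t s b (base + voLvl g + 1) (Sum.inr (e g))) (g : VOGate m) :
    ∀ w ∈ voSrcs bw e g, Pre t s b (base + voLvl g) w := by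
  cases g <;>
    simp only [voSrcs, voLvl, Finset.forall_mem_insert, Finset.forall_mem_image, Finset.forall_mem_union, Finset.mem_singleton,
      forall_eq, Finset.mem_univ, Finset.mem_filter, true_and, true_imp_iff] <;>
    (repeat' apply And.intro) <;>
    first
    | exact (hb _ _).of_le (Nat.le_add_right _ _)
    | exact (he _).of_le (by simp only [voLvl]; omega)
    | exact fun _ => (he _).of_le (by simp only [voLvl]; omega)
    | exact fun _ _ => (he _).of_le (by simp only [voLvl]; omega)

/-- Sources of the parts' comparison shape. [folklore] -/
theorem pre_vaSrcs {bw : Finset (WV m) → Fin (NB (wn m)) → Wire m} {e : VAGate m → Gt m} (hb : ∀ k j, Pre t s b base (bw k j))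
    (he : ∀ g, Pre t s b (base + vaLvl g + 1) (Sum.inr (e g))) (g : VAGate m) :
    ∀ w ∈ vaSrcs bw e g, Pre t s b (base + vaLvl g) w := by
  cases g <;>
    simp only [vaSrcs, vaLvl, Finset.forall_mem_insert, Finset.forall_mem_image, Finset.forall_mem_union, Finset.mem_singleton,
      forall_eq, Finset.mem_univ, Finset.mem_filter, true_and, true_imp_iff] <;>
    (repeat' apply And.intro) <;>
    first
    | exact (hb _ _).of_le (Nat.le_add_right _ _)
    | exact (he _).of_le (by simp only [vaLvl]; omega)
    | exact fun _ => (he _).of_le (by simp only [vaLvl]; omega)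
    | exact fun _ _ => (he _).of_le (by simp only [vaLvl]; omega)

/-- Sources of a refinement shape (inputs `Pre` at `base`, the shape embedded at `base + riLvl + 1`). [folklore] -/
theorem pre_riSrcs {ι : RIIn m} {e : RIGate m → Gt m} (hmem : ∀ v, Pre t s b base (ι.mem v)) (hadj : ∀ u v, Pre t s b base (ι.adj u v))
    (hlt0 : ∀ u v, Pre t s b base (ι.lt0 u v)) (heq0 : ∀ u v, Pre t s b base (ι.eq0 u v))
    (he : ∀ g, Pre t s b (base + riLvl g + 1) (Sum.inr (e g))) (g : RIGate m) :
    ∀ w ∈ riSrcs ι e g, Pre t s b (base + riLvl g) w := by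
  have hltW : ∀ (r : Fin (wn m + 1)) u v, Pre t s b (base + 12 * r) (riLtW ι e r u v) := by
    intro r u v
    unfold riLtW
    split_ifs with h
    · exact (hlt0 u v).of_le (Nat.le_add_right _ _)
    · exact (he _).of_le (by simp only [riLvl]; omega)
  cases g with
  | c r u w y =>
    simp only [riSrcs, riLvl, Finset.forall_mem_insert, Finset.mem_singleton, forall_eq]
    refine ⟨(hmem _).of_le (Nat.le_add_right _ _), (hadj _ _).of_le (Nat.le_add_right _ _), ?_⟩
    split_ifs with h
    · exact (heq0 _ _).of_le (Nat.le_add_right _ _)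
    · exact (he _).of_le (by simp only [riLvl]; omega)
  | cmp r u v w g =>
    simp only [riSrcs, riLvl]
    refine fun w' hw' => (pre_ccSrcs (base := base + 12 * r + 2) ?_ ?_ (fun g' => (he (.cmp r u v w g')).of_le ?_) g w' hw').of_le ?_
    · simp only [Finset.forall_mem_image, Finset.mem_univ, true_imp_iff]
      exact fun y => (he _).of_le (by simp only [riLvl]; omega)
    · simp only [Finset.forall_mem_image, Finset.mem_univ, true_imp_iff]
      exact fun y => (he _).of_le (by simp only [riLvl]; omega)
    · simp only [riLvl]; omega
    · omega
  | nmem w =>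
    simp only [riSrcs, riLvl, Finset.mem_singleton, forall_eq]
    exact (hmem _).of_le (Nat.le_add_right _ _)
  | nlt r w' w =>
    simp only [riSrcs, riLvl, Finset.mem_singleton, forall_eq]
    split_ifs with h
    · exact (hlt0 _ _).of_le (Nat.le_add_right _ _)
    · exact (he _).of_le (by simp only [riLvl]; omega)
  | pre r u v w w' =>
    simp only [riSrcs, riLvl, Finset.forall_mem_insert, Finset.mem_singleton, forall_eq]
    exact ⟨(he _).of_le (by simp only [riLvl]; omega), (he _).of_le (by simp only [riLvl]; omega),
      (he _).of_le (by simp only [riLvl, ccLvl]; omega)⟩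
  | allpre r u v w =>
    simp only [riSrcs, riLvl, Finset.forall_mem_image, Finset.mem_univ, true_imp_iff]
    exact fun _ => (he _).of_le (by simp only [riLvl]; omega)
  | wit r u v w =>
    simp only [riSrcs, riLvl, Finset.forall_mem_insert, Finset.mem_singleton, forall_eq]
    exact ⟨(hmem _).of_le (Nat.le_add_right _ _), (he _).of_le (by simp only [riLvl, ccLvl]; omega),
      (he _).of_le (by simp only [riLvl]; omega)⟩
  | prof r u v =>
    simp only [riSrcs, riLvl, Finset.forall_mem_image, Finset.mem_univ, true_imp_iff]
    exact fun _ => (he _).of_le (by simp only [riLvl]; omega)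
  | tie r u v =>
    simp only [riSrcs, riLvl, Finset.forall_mem_insert, Finset.mem_singleton, forall_eq]
    refine ⟨?_, (he _).of_le (by simp only [riLvl]; omega)⟩
    split_ifs with h
    · exact (heq0 _ _).of_le (Nat.le_add_right _ _)
    · exact (he _).of_le (by simp only [riLvl]; omega)
  | ltS r u v =>
    simp only [riSrcs, riLvl, Finset.forall_mem_insert, Finset.mem_singleton, forall_eq]
    refine ⟨?_, (he _).of_le (by simp only [riLvl]; omega)⟩
    split_ifs with h
    · exact (hlt0 _ _).of_le (Nat.le_add_right _ _)
    · exact (he _).of_le (by simp only [riLvl]; omega)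
  | eqS r u v =>
    simp only [riSrcs, riLvl, Finset.forall_mem_insert, Finset.mem_singleton, forall_eq]
    exact ⟨(he _).of_le (by simp only [riLvl]; omega), (he _).of_le (by simp only [riLvl]; omega)⟩
  | vc w v =>
    simp only [riSrcs, riLvl, Finset.forall_mem_insert, Finset.mem_singleton, forall_eq]
    exact ⟨(hmem _).of_le (Nat.le_add_right _ _), (hltW _ _ _).of_le (by simp only [Fin.val_last]; omega)⟩
  | vge v t' =>
    simp only [riSrcs, riLvl, Finset.forall_mem_image, Finset.mem_univ, true_imp_iff]
    exact fun _ => (he _).of_le (by simp only [riLvl]; omega)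
  | vnge v t' =>
    simp only [riSrcs, riLvl, Finset.mem_singleton, forall_eq]
    exact (he _).of_le (by simp only [riLvl]; omega)
  | vinA v t' =>
    simp only [riSrcs, riLvl, Finset.forall_mem_insert, Finset.mem_singleton, forall_eq]
    exact ⟨(hmem _).of_le (Nat.le_add_right _ _), (he _).of_le (by simp only [riLvl]; omega), (he _).of_le (by simp only [riLvl]; omega)⟩
  | vnm v =>
    simp only [riSrcs, riLvl, Finset.mem_singleton, forall_eq]
    exact (hmem _).of_le (Nat.le_add_right _ _)
  | vval v t' =>
    simp only [riSrcs, riLvl]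
    split_ifs with h
    · simp only [Finset.forall_mem_insert, Finset.mem_singleton, forall_eq]
      exact ⟨(he _).of_le (by simp only [riLvl]; omega), (he _).of_le (by simp only [riLvl]; omega)⟩
    · simp only [Finset.mem_singleton, forall_eq]
      exact (he _).of_le (by simp only [riLvl]; omega)

end shapes

end WCanon.R2c

end Summit.PneNP.PneNP.Theorems
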